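import Literature.Geometry.Riemannian.SphericalCylinderSmallScaleDominationProofs
import Mathlib
import HarnessLib

/-!
# Mid-low-scale certificate for the conformal kernel domination (stub `stub_certMidLow`)

Helper for the line `conformal-kernel-domination` of the crux
`Summit.SmoothPoincare4.SmoothPoincare4.Theses.CylinderEntropy.SliceIsolation` (crux item
stmt-SmoothPoincare4-7632).  In the normalised variables `T = t/‖y‖² > 0`, `u = z₅ − log ‖y‖`,
`s = ⟨z', ŷ⟩ ∈ [−1, 1]` the Jacobian-weighted pulled-back Euclidean Gaussian kernel times `V = 8π²/3` is
`pulled(T,u,s) = (8π²/3)·((4πT)²)⁻¹·exp(4u)·exp(−(exp(2u) − 2·exp(u)·s + 1)/(4T))`.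
We prove the MID-LOW-SCALE certificate, sharpening the landed small-scale one
(`CylinderEntropySliceIsolationStubCertSmall.lean`, `T ≤ 10⁻⁵`) to the range `10⁻⁵ ≤ T ≤ 2·10⁻⁴`:
ONE broadened on-axis cylinder ("zonal") kernel `w · 𝔥(τ, s) · exp(−(u − σ)²/(4τ))` at the SHIFTED centre
`σ = 8τ`, scale `τ = (1+κ)T`, weight `w = (1+κ)² e^{16τ}`, plus an area atom `c`, dominate `pulled(T,·,·)`
on `ℝ × [−1,1]`, with total mass `w + c ≤ 147/100`.

Constants: `κ = 9/50`, `c = 1/50`, near region `Q ≤ q₀ := 11/625` where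
`Q = (eᵘ − 1)² + 2eᵘ(1 − s) = e^{2u} − 2eᵘ s + 1`.
* near region: by the Cheeger–Yau minorant (`CheegerYauZonalSphereFour_holds`)
  `(8π²/3)(4πτ)⁻² e^{−θ²/4τ} ≤ 𝔥(τ, cos θ)` it suffices to compare exponents; with the shift `σ = 8τ`
  the linear terms `4u` cancel EXACTLY against the cross term of `−(u−σ)²/(4τ)` and `e^{16τ}` against
  `−σ²/(4τ)`, leaving the key inequality `θ² + u² ≤ (1+κ) Q` (`certMidLow_near`), proved from
  `1 − cos θ ≥ θ²/2 − 5θ⁴/96` (`Real.cos_bound`) and `1 − e^{−x} ≥ x(1 − x/2)` (`x = −u ≤ 18/125`);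
* far region `Q > q₀`: `pulled ≤ c`, since `(8π²/3)(4πT)⁻² = 1/(6T²)` and either `eᵘ ≤ 2`, where
  `16 e^{−q₀/4T}/(6T²) ≤ 1/50` by `(25·10⁸/363) x² ≤ eˣ` for `x = 11/(2500T) ≥ 22`, or `eᵘ > 2`, where
  `Q ≥ e^{2u}/4` and `y⁴/24 ≤ eʸ` give `pulled ≤ 16384 T²`.
The lower bound `10⁻⁵ ≤ T` is only used through `0 < T`.
-/

noncomputable section

-- the registered namespace `Summit.SmoothPoincare4.SmoothPoincare4.Theorems…` repeats a component
set_option linter.dupNamespace false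

namespace Summit.SmoothPoincare4.SmoothPoincare4.Theorems.CylinderEntropySliceIsolation

open Literature.Geometry.Riemannian Literature.Geometry.Riemannian.SphericalCylinderEntropy
open Literature.Geometry.Riemannian.SphericalCylinderConformal (le_one_of_cos_gt)

/-- The total mass of the mid-low-scale certificate: `(59/50)² e^{(472/25)T} + 1/50 ≤ 147/100` for
`0 ≤ T ≤ 1/5000` (`eˣ ≤ 1 + x + x²` for `|x| ≤ 1`). [folklore] -/
theorem certMidLow_mass {T : ℝ} (hT0 : 0 ≤ T) (hT : T ≤ 1 / 5000) :
    (59 / 50 : ℝ) ^ 2 * Real.exp (472 / 25 * T) + 1 / 50 ≤ 147 / 100 := by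
  have hx : |(472 / 25 * T : ℝ)| ≤ 1 := by
    rw [abs_le]
    constructor <;> linarith
  have he := Real.abs_exp_sub_one_sub_id_le hx
  have he' : Real.exp (472 / 25 * T) ≤ 1 + 472 / 25 * T + (472 / 25 * T) ^ 2 := by
    have := (abs_le.1 he).2
    linarith
  nlinarith [he', mul_le_mul_of_nonneg_left hT hT0]

/-- For `x ≥ 22`, `(25·10⁸/363) x² ≤ eˣ` (from `e ≥ 2.718`, `2.718²² ≥ 34·10⁸` and
`e^y ≥ 1 + y + y²/2` at `y = x − 22`). [folklore] -/
theorem certMidLow_exp_sq_le {x : ℝ} (hx : 22 ≤ x) : 2500000000 / 363 * x ^ 2 ≤ Real.exp x := by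
  have he1 : (2.718 : ℝ) ≤ Real.exp 1 := by linarith [Real.exp_one_gt_d9]
  have hpow : Real.exp 1 ^ 22 = Real.exp 22 := by
    rw [← Real.exp_nat_mul]
    norm_num
  have h22 : (3400000000 : ℝ) ≤ Real.exp 22 := by
    calc (3400000000 : ℝ) ≤ 2.718 ^ 22 := by norm_num
      _ ≤ Real.exp 1 ^ 22 := pow_le_pow_left₀ (by norm_num) he1 22
      _ = Real.exp 22 := hpow
  obtain ⟨y, hy0, rfl⟩ : ∃ y : ℝ, 0 ≤ y ∧ x = 22 + y := ⟨x - 22, by linarith, by ring⟩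
  have hexp : Real.exp (22 + y) = Real.exp 22 * Real.exp y := Real.exp_add 22 y
  have hq : 1 + y + y ^ 2 / 2 ≤ Real.exp y := Real.quadratic_le_exp_of_nonneg hy0
  rw [hexp]
  calc 2500000000 / 363 * (22 + y) ^ 2 ≤ 3400000000 * (1 + y + y ^ 2 / 2) := by
        nlinarith [sq_nonneg y]
    _ ≤ Real.exp 22 * Real.exp y := mul_le_mul h22 hq (by positivity) (Real.exp_pos _).le

/-- **Far region.** If `0 < T ≤ 1/5000`, `(eᵘ − 1)² ≤ Q` and `Q > 11/625`, then
`(1/(6T²)) e^{4u} e^{−Q/4T} ≤ 1/50`: the far region lies below the area atom. [folklore] -/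
theorem certMidLow_far {T u Q : ℝ} (hT : 0 < T) (hT' : T ≤ 1 / 5000)
    (hQ1 : (Real.exp u - 1) ^ 2 ≤ Q) (hQ2 : (11 / 625 : ℝ) < Q) :
    1 / (6 * T ^ 2) * Real.exp (4 * u) * Real.exp (-Q / (4 * T)) ≤ 1 / 50 := by
  have hr0 : 0 < Real.exp u := Real.exp_pos u
  have h4u : Real.exp (4 * u) = Real.exp u ^ 4 := by rw [← Real.exp_nat_mul]; norm_num
  rcases le_or_gt (Real.exp u) 2 with hle | hgt
  · -- `eᵘ ≤ 2`: `e^{4u} ≤ 16` and `e^{−Q/4T} ≤ e^{−x}`, `x = 11/(2500T) ≥ 22`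
    set x : ℝ := 11 / (2500 * T) with hx
    have hx22 : 22 ≤ x := by
      rw [hx, le_div_iff₀ (by positivity)]
      linarith
    have hex : 2500000000 / 363 * x ^ 2 ≤ Real.exp x := certMidLow_exp_sq_le hx22
    have h16 : Real.exp (4 * u) ≤ 16 := by
      rw [h4u]
      calc Real.exp u ^ 4 ≤ 2 ^ 4 := pow_le_pow_left₀ hr0.le hle 4
        _ = 16 := by norm_num
    have hE : Real.exp (-Q / (4 * T)) ≤ (Real.exp x)⁻¹ := by
      rw [← Real.exp_neg]
      apply Real.exp_le_exp.2
      have h1 : x * (4 * T) = 11 / 625 := by rw [hx]; field_simp; norm_num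
      rw [div_le_iff₀ (by positivity : (0 : ℝ) < 4 * T)]
      linarith
    have hkey : 400 / 3 ≤ T ^ 2 * Real.exp x := by
      have h1 : T ^ 2 * (2500000000 / 363 * x ^ 2) = 400 / 3 := by rw [hx]; field_simp; norm_num
      rw [← h1]
      exact mul_le_mul_of_nonneg_left hex (sq_nonneg T)
    have hTe : 0 < T ^ 2 * Real.exp x := by positivity
    calc 1 / (6 * T ^ 2) * Real.exp (4 * u) * Real.exp (-Q / (4 * T))
        ≤ 1 / (6 * T ^ 2) * 16 * (Real.exp x)⁻¹ := by gcongr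
      _ = 8 / 3 / (T ^ 2 * Real.exp x) := by field_simp; ring
      _ ≤ 8 / 3 / (400 / 3) := by gcongr
      _ = 1 / 50 := by norm_num
  · -- `eᵘ > 2`: `Q ≥ e^{2u}/4`, `y = e^{2u}/(16T)`, `y⁴/24 ≤ eʸ`
    set r := Real.exp u with hr
    have hprod : 0 ≤ (r - 2) * (3 * r - 2) := mul_nonneg (by linarith) (by linarith)
    have hQr : r ^ 2 / 4 ≤ Q := by nlinarith [hprod, hQ1]
    set y : ℝ := r ^ 2 / (16 * T) with hy
    have hy0 : 0 ≤ y := by positivity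
    have hE : Real.exp (-Q / (4 * T)) ≤ Real.exp (-y) := by
      apply Real.exp_le_exp.2
      rw [hy, div_le_iff₀ (by positivity : (0 : ℝ) < 4 * T)]
      have h1 : r ^ 2 / (16 * T) * (4 * T) = r ^ 2 / 4 := by field_simp; ring
      linarith
    have hexp : y ^ 4 / 24 ≤ Real.exp y := by
      have h := Real.pow_div_factorial_le_exp y hy0 4
      norm_num [Nat.factorial] at h
      exact h
    have hr2 : 4 ≤ r ^ 2 := by nlinarith
    have hr4 : 16 ≤ r ^ 4 := by nlinarith [hr2]
    have hT2 : T ^ 2 ≤ 1 / 25000000 := by nlinarith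
    have halg : 1 / (6 * T ^ 2) * r ^ 4 ≤ 1 / 50 * (y ^ 4 / 24) := by
      have e1 : 1 / 50 * (y ^ 4 / 24) = r ^ 8 / (78643200 * T ^ 4) := by rw [hy]; field_simp; ring
      have e2 : 1 / (6 * T ^ 2) * r ^ 4 = r ^ 4 / (6 * T ^ 2) := by ring
      rw [e1, e2, div_le_div_iff₀ (by positivity) (by positivity)]
      have h := mul_nonneg (mul_nonneg (pow_nonneg hT.le 2) (pow_nonneg hr0.le 4))
        (show (0 : ℝ) ≤ 6 * r ^ 4 - 78643200 * T ^ 2 by nlinarith [hr4, hT2])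
      nlinarith [h]
    calc 1 / (6 * T ^ 2) * Real.exp (4 * u) * Real.exp (-Q / (4 * T))
        ≤ 1 / (6 * T ^ 2) * r ^ 4 * Real.exp (-y) := by rw [h4u]; gcongr
      _ ≤ 1 / 50 * (y ^ 4 / 24) * Real.exp (-y) := by gcongr
      _ ≤ 1 / 50 * Real.exp y * Real.exp (-y) := by gcongr
      _ = 1 / 50 := by rw [mul_assoc, ← Real.exp_add, add_neg_cancel, Real.exp_zero, mul_one]

/-- **Angular part of the sharp near-region comparison.** If `|s| ≤ 1`, `r ≥ 13/15` and
`2r(1 − s) ≤ 11/625`, then `arccos(s)² ≤ (59/50) · 2r(1 − s)`: with `θ = arccos s ≤ 1`,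
`1 − cos θ ≥ θ²/2 − 5θ⁴/96` (`Real.cos_bound`) and `θ² ≤ (96/43)(1 − s) ≤ (96/43)(165/16250)`. [folklore] -/
theorem certMidLow_angle {r s : ℝ} (hs1 : -1 ≤ s) (hs2 : s ≤ 1) (hr : 13 / 15 ≤ r)
    (h : 2 * r * (1 - s) ≤ 11 / 625) :
    (Real.arccos s) ^ 2 ≤ 59 / 50 * (2 * r * (1 - s)) := by
  set θ := Real.arccos s with hθ
  have hθ0 : 0 ≤ θ := Real.arccos_nonneg s
  have hθπ : θ ≤ Real.pi := Real.arccos_le_pi s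
  have hcos : Real.cos θ = s := Real.cos_arccos hs1 hs2
  have h1s0 : 0 ≤ 1 - s := by linarith
  have hr1s : 0 ≤ (r - 13 / 15) * (1 - s) := mul_nonneg (by linarith) h1s0
  have h2r : 26 / 15 * (1 - s) ≤ 2 * r * (1 - s) := by nlinarith [hr1s]
  have h1s : 1 - s ≤ 165 / 16250 := by linarith
  have hcgt : 53 / 96 < Real.cos θ := by rw [hcos]; linarith
  have hθ1 : θ ≤ 1 := le_one_of_cos_gt hθπ hcgt
  have hb := Real.cos_bound (x := θ) (by rw [abs_of_nonneg hθ0]; exact hθ1)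
  rw [abs_of_nonneg hθ0, hcos] at hb
  have hcb : s ≤ 1 - θ ^ 2 / 2 + θ ^ 4 * (5 / 96) := by linarith [(abs_sub_le_iff.1 hb).1]
  have hθ2 : 0 ≤ θ ^ 2 := sq_nonneg θ
  have hθsq1 : θ ^ 2 ≤ 1 := by nlinarith
  have hθ4 : θ ^ 4 ≤ θ ^ 2 := by nlinarith [hθ2]
  have hθsq : 43 / 96 * θ ^ 2 ≤ 1 - s := by linarith
  have hθB : θ ^ 2 ≤ 96 / 43 * (165 / 16250) := by linarith
  have hθ4' : θ ^ 4 ≤ 96 / 43 * (165 / 16250) * θ ^ 2 := by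
    have e : θ ^ 4 = θ ^ 2 * θ ^ 2 := by ring
    rw [e]
    exact mul_le_mul_of_nonneg_right hθB hθ2
  have hlow : θ ^ 2 * (1 / 2 - 5 / 96 * (96 / 43 * (165 / 16250))) ≤ 1 - s := by linarith
  nlinarith [hlow, h2r, hθ2]

/-- **Radial part of the sharp near-region comparison.** If `eᵘ ≥ 13/15` then
`u² ≤ (59/50)(eᵘ − 1)²`: for `u ≥ 0`, `eᵘ − 1 ≥ u`; for `u = −x < 0`, `x ≤ 18/125` and
`1 − e^{−x} ≥ x(1 − x/2)` (from `eˣ ≥ 1 + x + x²/2`), with `(59/50)(1 − 9/125)² ≥ 1`. [folklore] -/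
theorem certMidLow_height {u : ℝ} (hr : 13 / 15 ≤ Real.exp u) :
    u ^ 2 ≤ 59 / 50 * (Real.exp u - 1) ^ 2 := by
  rcases le_or_gt 0 u with hu0 | hu0
  · -- `0 ≤ u ≤ eᵘ - 1`
    have h1 : u ≤ Real.exp u - 1 := by linarith [Real.add_one_le_exp u]
    have h2 : u ^ 2 ≤ (Real.exp u - 1) ^ 2 := pow_le_pow_left₀ hu0 h1 2
    nlinarith [sq_nonneg (Real.exp u - 1)]
  · -- `u < 0`, `x = -u`
    obtain ⟨x, hx0, rfl⟩ : ∃ x : ℝ, 0 < x ∧ u = -x := ⟨-u, by linarith, by ring⟩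
    have hprod : Real.exp x * Real.exp (-x) = 1 := by
      rw [← Real.exp_add, add_neg_cancel, Real.exp_zero]
    have hxpos : 0 < Real.exp x := Real.exp_pos x
    -- `x ≤ 18/125`
    have hx1 : x ≤ 18 / 125 := by
      by_contra hcon
      push Not at hcon
      have hq : 1 + 18 / 125 + (18 / 125 : ℝ) ^ 2 / 2 ≤ Real.exp (18 / 125) :=
        Real.quadratic_le_exp_of_nonneg (by norm_num)
      have hlt : Real.exp (18 / 125) < Real.exp x := Real.exp_lt_exp.2 hcon
      have h1 : Real.exp x * (13 / 15) ≤ Real.exp x * Real.exp (-x) :=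
        mul_le_mul_of_nonneg_left hr hxpos.le
      rw [hprod] at h1
      norm_num at hq
      nlinarith
    -- `e^{-x} ≤ 1 - x + x²/2`
    have hq : 1 + x + x ^ 2 / 2 ≤ Real.exp x := Real.quadratic_le_exp_of_nonneg hx0.le
    have hpos : 0 ≤ 1 - x + x ^ 2 / 2 := by nlinarith [sq_nonneg (x - 1)]
    have hEu : Real.exp (-x) ≤ 1 - x + x ^ 2 / 2 := by
      by_contra hcon
      push Not at hcon
      have h1 : Real.exp x * (1 - x + x ^ 2 / 2) < Real.exp x * Real.exp (-x) :=
        mul_lt_mul_of_pos_left hcon hxpos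
      have h2 : (1 + x + x ^ 2 / 2) * (1 - x + x ^ 2 / 2) ≤ Real.exp x * (1 - x + x ^ 2 / 2) :=
        mul_le_mul_of_nonneg_right hq hpos
      have h3 : (1 + x + x ^ 2 / 2) * (1 - x + x ^ 2 / 2) = 1 + x ^ 4 / 4 := by ring
      rw [hprod] at h1
      rw [h3] at h2
      nlinarith [pow_nonneg hx0.le 4]
    -- `1 - e^{-x} ≥ x (1 - x/2) ≥ 0`
    have hlow : x * (1 - x / 2) ≤ 1 - Real.exp (-x) := by nlinarith
    have hl0 : 0 ≤ x * (1 - x / 2) := mul_nonneg hx0.le (by linarith)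
    have h5 : (x * (1 - x / 2)) ^ 2 ≤ (1 - Real.exp (-x)) ^ 2 := pow_le_pow_left₀ hl0 hlow 2
    have h6a : (116 / 125 : ℝ) ≤ 1 - x / 2 := by linarith
    have h6 : 1 ≤ 59 / 50 * (1 - x / 2) ^ 2 := by
      nlinarith [mul_le_mul h6a h6a (by norm_num) (by linarith)]
    calc (-x) ^ 2 = x ^ 2 := by ring
      _ ≤ 59 / 50 * (1 - x / 2) ^ 2 * x ^ 2 := by
          nlinarith [mul_le_mul_of_nonneg_right h6 (sq_nonneg x)]
      _ = 59 / 50 * (x * (1 - x / 2)) ^ 2 := by ring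
      _ ≤ 59 / 50 * (1 - Real.exp (-x)) ^ 2 := mul_le_mul_of_nonneg_left h5 (by norm_num)
      _ = 59 / 50 * (Real.exp (-x) - 1) ^ 2 := by ring

/-- **Sharp near-region comparison** (`κ = 9/50`, near region `Q ≤ 11/625`): if `|s| ≤ 1` and
`Q = (eᵘ − 1)² + 2eᵘ(1 − s) ≤ 11/625` then `arccos(s)² + u² ≤ (59/50) Q`. [folklore] -/
theorem certMidLow_near {u s : ℝ} (hs1 : -1 ≤ s) (hs2 : s ≤ 1)
    (hnear : (Real.exp u - 1) ^ 2 + 2 * Real.exp u * (1 - s) ≤ 11 / 625) :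
    (Real.arccos s) ^ 2 + u ^ 2 ≤ 59 / 50 * ((Real.exp u - 1) ^ 2 + 2 * Real.exp u * (1 - s)) := by
  have hA0 : 0 ≤ 2 * Real.exp u * (1 - s) :=
    mul_nonneg (mul_nonneg zero_le_two (Real.exp_pos u).le) (by linarith)
  have hB0 : 0 ≤ (Real.exp u - 1) ^ 2 := sq_nonneg _
  have hu : (Real.exp u - 1) ^ 2 ≤ (2 / 15) ^ 2 := by linarith
  obtain ⟨hlo, -⟩ := abs_le_of_sq_le_sq' hu (by norm_num)
  have hr : 13 / 15 ≤ Real.exp u := by linarith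
  have hang : 2 * Real.exp u * (1 - s) ≤ 11 / 625 := by linarith
  have h1 := certMidLow_angle hs1 hs2 hr hang
  have h2 := certMidLow_height hr
  linarith

/-- **Mid-low-scale certificate** (`10⁻⁵ ≤ T ≤ 2·10⁻⁴`, one SHIFTED zonal atom plus the area atom): with
`τ = (59/50) T`, `σ = 8τ = (236/25) T`, `w = (59/50)² e^{(472/25)T}`, `c = 1/50` (mass `≤ 147/100`) the
broadened, shifted on-axis cylinder kernel plus the area atom dominate the Jacobian-weighted pulled-back
Euclidean Gaussian kernel times `V = 8π²/3` on `ℝ × [−1,1]`.  Registered stub `stub_certMidLow` of the line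
`conformal-kernel-domination`. [folklore] -/
theorem stub_certMidLow :
    ∀ T : ℝ, 1 / 100000 ≤ T → T ≤ 1 / 5000 → ∃ σ τ w c : ℝ, 0 < τ ∧ 0 ≤ w ∧ 0 ≤ c ∧ w + c ≤ 147 / 100 ∧
      ∀ u s : ℝ, -1 ≤ s → s ≤ 1 →
        (8 * Real.pi ^ 2 / 3) * ((4 * Real.pi * T) ^ 2)⁻¹ * Real.exp (4 * u) *
            Real.exp (-(Real.exp (2 * u) - 2 * Real.exp u * s + 1) / (4 * T)) ≤
          w * (zonal τ s * Real.exp (-(u - σ) ^ 2 / (4 * τ))) + c := by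
  intro T hT1 hT2
  have hT : 0 < T := by linarith
  refine ⟨236 / 25 * T, 59 / 50 * T, (59 / 50) ^ 2 * Real.exp (472 / 25 * T), 1 / 50, by positivity,
    by positivity, by norm_num, certMidLow_mass hT.le hT2, fun u s hs1 hs2 => ?_⟩
  have hTne : T ≠ 0 := hT.ne'
  have hπ : Real.pi ≠ 0 := Real.pi_ne_zero
  set σ : ℝ := 236 / 25 * T with hσ
  set τ : ℝ := 59 / 50 * T with hτ
  have hτ0 : 0 < τ := by positivity
  -- the Euclidean defect `Q`
  set Q : ℝ := (Real.exp u - 1) ^ 2 + 2 * Real.exp u * (1 - s) with hQ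
  have hQeq : Real.exp (2 * u) - 2 * Real.exp u * s + 1 = Q := by
    have h2 : Real.exp (2 * u) = Real.exp u ^ 2 := by rw [← Real.exp_nat_mul]; norm_num
    rw [h2, hQ]; ring
  rw [hQeq]
  -- Cheeger–Yau at scale `τ`; positivity of the typed zonal kernel
  have hCY := CheegerYauZonalSphereFour_holds τ hτ0 s hs1 hs2
  have hZpos : 0 < zonal τ s := lt_of_lt_of_le (by positivity) hCY
  have hatom : 0 ≤ (59 / 50 : ℝ) ^ 2 * Real.exp (472 / 25 * T) *
      (zonal τ s * Real.exp (-(u - σ) ^ 2 / (4 * τ))) :=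
    mul_nonneg (by positivity) (mul_nonneg hZpos.le (Real.exp_pos _).le)
  rcases le_or_gt Q (11 / 625) with hnear | hfar
  · -- NEAR REGION: `θ² + u² ≤ (1+κ) Q`, and the shift `σ = 8τ` cancels the linear terms exactly
    have hkey := certMidLow_near hs1 hs2 hnear
    set θ := Real.arccos s with hθ
    have h4τ : 0 < 4 * τ := by positivity
    have hexp : Real.exp (4 * u) * Real.exp (-Q / (4 * T)) ≤
        Real.exp (472 / 25 * T) * (Real.exp (-θ ^ 2 / (4 * τ)) * Real.exp (-(u - σ) ^ 2 / (4 * τ))) := by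
      rw [← Real.exp_add, ← Real.exp_add, ← Real.exp_add]
      apply Real.exp_le_exp.2
      have h1 : -(59 / 50 * Q - u ^ 2) / (4 * τ) ≤ -θ ^ 2 / (4 * τ) :=
        div_le_div_of_nonneg_right (by linarith) h4τ.le
      have h2 : 4 * u + -Q / (4 * T) =
          472 / 25 * T + (-(59 / 50 * Q - u ^ 2) / (4 * τ) + -(u - σ) ^ 2 / (4 * τ)) := by
        rw [hτ, hσ]
        field_simp
        ring
      linarith
    have hpref : (8 * Real.pi ^ 2 / 3) * ((4 * Real.pi * T) ^ 2)⁻¹ =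
        (59 / 50) ^ 2 * ((8 * Real.pi ^ 2 / 3) * ((4 * Real.pi * τ) ^ 2)⁻¹) := by
      rw [hτ]
      field_simp
    calc (8 * Real.pi ^ 2 / 3) * ((4 * Real.pi * T) ^ 2)⁻¹ * Real.exp (4 * u) * Real.exp (-Q / (4 * T))
        = (8 * Real.pi ^ 2 / 3) * ((4 * Real.pi * T) ^ 2)⁻¹ *
            (Real.exp (4 * u) * Real.exp (-Q / (4 * T))) := by ring
      _ ≤ (8 * Real.pi ^ 2 / 3) * ((4 * Real.pi * T) ^ 2)⁻¹ *
            (Real.exp (472 / 25 * T) *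
              (Real.exp (-θ ^ 2 / (4 * τ)) * Real.exp (-(u - σ) ^ 2 / (4 * τ)))) :=
          mul_le_mul_of_nonneg_left hexp (by positivity)
      _ = (59 / 50) ^ 2 * Real.exp (472 / 25 * T) *
            (((8 * Real.pi ^ 2 / 3) * ((4 * Real.pi * τ) ^ 2)⁻¹ * Real.exp (-θ ^ 2 / (4 * τ))) *
              Real.exp (-(u - σ) ^ 2 / (4 * τ))) := by
          rw [hpref]; ring
      _ ≤ (59 / 50) ^ 2 * Real.exp (472 / 25 * T) *
            (zonal τ s * Real.exp (-(u - σ) ^ 2 / (4 * τ))) := by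
          gcongr
      _ ≤ (59 / 50) ^ 2 * Real.exp (472 / 25 * T) *
            (zonal τ s * Real.exp (-(u - σ) ^ 2 / (4 * τ))) + 1 / 50 := by
          linarith
  · -- FAR REGION
    have hpre : (8 * Real.pi ^ 2 / 3) * ((4 * Real.pi * T) ^ 2)⁻¹ = 1 / (6 * T ^ 2) := by
      field_simp
      ring
    have hQ1 : (Real.exp u - 1) ^ 2 ≤ Q := by
      have h := mul_nonneg (mul_nonneg (zero_le_two (α := ℝ)) (Real.exp_pos u).le) (sub_nonneg.2 hs2)
      rw [hQ]
      linarith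
    have hfarb := certMidLow_far hT hT2 hQ1 hfar
    rw [hpre]
    linarith

end Summit.SmoothPoincare4.SmoothPoincare4.Theorems.CylinderEntropySliceIsolation

end
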